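import Summits.AnomalousDissipation.AnomalousDissipation.Theorems.SawtoothPulseCascadeK1LocalisedCascadeSidebandEnergy

/-!
# K1loc, line `Spectral` / thin start — helper: THE PARITY-HALVED SIDEBAND ENERGY OF THE EXACT CHIRP (even strain)

Helper file of the prover lane on the crux `K1LocalisedCascade` (stmt-AnomalousDissipation-19491), route
`SawtoothPulseCascade` (glue for the fibre-`L²` START of the ledger; companion of `…SidebandEnergy`).  At even strain `λ`
(every fibre `λ = nγ` when `γ` is even, e.g. `γ = 8`) the exact one-tooth chirp has `ĝ₀(q) = 0` whenever `λ + q` is even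
(`…ExactChirp.fourierCoeff_exactChirp_eq_zero_of_even`), so only odd `q` contribute to the sideband energy:
* `sum_inv_sq_le_of_le_abs_of_odd` — `Σ_{j∈J} 1/j² ≤ 1/(D−1)` for a finite set `J` of ODD integers with `|j| ≥ D ≥ 2`
  (`j = ±(2i+1)`, `1/j² ≤ (1/i − 1/(i+1))/4`);
* **`sum_sq_norm_fourierCoeff_exactChirp_sideband_le_of_even`** — `Σ_{q∈S} ‖ĝ₀(q)‖² ≤ (4/π²)·1/(D−1)` for every finite
  `S ⊆ {q : D ≤ |q+λ| ∧ D ≤ |q−λ|}`, `D ≥ 2`, `λ` even (half of `…SidebandEnergy.sum_sq_norm_fourierCoeff_exactChirp_sideband_le`).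
No definitions; nothing about the crux. [cite: Grafakos2014, Prop. 3.1.2 (5)] [problem: turb]
-/

-- `Summit.<Summit>.<Problem>`: single-conjunct summit, the duplicate namespace segment is deliberate.
set_option linter.dupNamespace false

noncomputable section

namespace Summit.AnomalousDissipation.AnomalousDissipation.Theorems.SawtoothPulseCascade.K1Start

open MeasureTheory Set Filter Topology UnitAddTorus Function Complex AddCircle
open scoped Real
open Literature.Analysis Literature.Analysis.FunctionSpaces Literature.Analysis.FunctionSpaces.Torus Literature.Analysis.FluidPDE
open Literature.Analysis.FluidPDE.SawtoothCascade

/-! ## §3 Parity-halved sideband energy (even `λ`: only odd `q` contribute) -/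

/-- **Inverse squares over ODD integers beyond `D`**: for a finite set `J` of odd integers with `|j| ≥ D ≥ 2`,
`Σ_{j∈J} 1/j² ≤ 1/(D−1)` (`j = ±(2i+1)`, `1/j² ≤ 1/(4i(i+1)) = (1/i − 1/(i+1))/4`, telescoping). [folklore] -/
theorem sum_inv_sq_le_of_le_abs_of_odd {D : ℕ} (hD : 2 ≤ D) (J : Finset ℤ) (hJ : ∀ j ∈ J, (D : ℤ) ≤ |j|)
    (hodd : ∀ j ∈ J, Odd j) :
    ∑ j ∈ J, 1 / ((j : ℝ)) ^ 2 ≤ 1 / ((D : ℝ) - 1) := by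
  classical
  have hD1 : (1 : ℝ) ≤ (D : ℝ) - 1 := by
    have : (2 : ℝ) ≤ D := by exact_mod_cast hD
    linarith
  -- the half-integer index `i = (|j| - 1)/2 ≥ 1` and the telescoping bound over `i₀ ≤ i ≤ M`
  have htel : ∀ (i₀ M : ℕ), 1 ≤ i₀ → ∑ i ∈ Finset.Icc i₀ M, 1 / ((2 * (i : ℝ) + 1)) ^ 2 ≤ 1 / (4 * (i₀ : ℝ)) := by
    intro i₀ M hi₀
    have hi₀r : (1 : ℝ) ≤ i₀ := by exact_mod_cast hi₀
    have key : ∀ M : ℕ, ∑ i ∈ Finset.Icc i₀ M, 1 / ((2 * (i : ℝ) + 1)) ^ 2 ≤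
        1 / (4 * (i₀ : ℝ)) - 1 / (4 * (max (M : ℝ) ((i₀ : ℝ) - 1) + 1)) := by
      intro M
      induction M with
      | zero =>
        rw [Finset.Icc_eq_empty (by omega), Finset.sum_empty]
        have : max ((0 : ℕ) : ℝ) ((i₀ : ℝ) - 1) = (i₀ : ℝ) - 1 := max_eq_right (by push_cast; linarith)
        rw [this, sub_add_cancel]; linarith
      | succ M ih =>
        by_cases hle : i₀ ≤ M + 1
        · rw [Finset.sum_Icc_succ_top hle]
          have hM1 : (i₀ : ℝ) - 1 ≤ (M : ℝ) := by
            have : (i₀ : ℝ) ≤ (M : ℝ) + 1 := by exact_mod_cast hle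
            linarith
          rw [max_eq_left hM1] at ih
          have hmax : max (((M + 1 : ℕ)) : ℝ) ((i₀ : ℝ) - 1) = (M : ℝ) + 1 := by
            push_cast; exact max_eq_left (by linarith)
          rw [hmax]
          have hM0 : (0 : ℝ) ≤ M := Nat.cast_nonneg M
          have hstep : 1 / ((2 * (((M + 1 : ℕ)) : ℝ) + 1)) ^ 2 ≤ 1 / (4 * ((M : ℝ) + 1)) - 1 / (4 * ((M : ℝ) + 1 + 1)) := by
            push_cast
            rw [div_sub_div _ _ (by positivity) (by positivity), div_le_div_iff₀ (by positivity) (by positivity)]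
            nlinarith
          linarith
        · push Not at hle
          rw [Finset.Icc_eq_empty (by omega), Finset.sum_empty]
          have : max (((M + 1 : ℕ)) : ℝ) ((i₀ : ℝ) - 1) = (i₀ : ℝ) - 1 := by
            refine max_eq_right ?_
            have : (M : ℝ) + 1 + 1 ≤ i₀ := by exact_mod_cast hle
            push_cast; linarith
          rw [this, sub_add_cancel]; linarith
    have h := key M
    have : 0 < max (M : ℝ) ((i₀ : ℝ) - 1) + 1 := by
      have := le_max_right (M : ℝ) ((i₀ : ℝ) - 1); linarith
    have : 0 ≤ 1 / (4 * (max (M : ℝ) ((i₀ : ℝ) - 1) + 1)) := by positivity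
    linarith
  -- index data
  obtain ⟨M, hM⟩ : ∃ M : ℕ, ∀ j ∈ J, |j| ≤ (M : ℤ) := by
    refine ⟨J.sup fun j => (|j|).toNat, fun j hj => ?_⟩
    have h := Finset.le_sup (f := fun j => (|j|).toNat) hj
    have : (|j|).toNat = |j| := Int.toNat_of_nonneg (abs_nonneg j)
    omega
  -- `i₀ := (D' - 1)/2` where every odd `|j| ≥ D` has `|j| = 2i+1` with `i ≥ i₀`; we use `i₀ = D / 2` (`2 i₀ ≤ D ≤ 2i₀ + 1`)
  set i₀ : ℕ := D / 2 with hi₀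
  have hi₀1 : 1 ≤ i₀ := by omega
  have hi₀D : (D : ℝ) - 1 ≤ 2 * (i₀ : ℝ) := by
    have : D ≤ 2 * i₀ + 1 := by omega
    have : (D : ℝ) ≤ 2 * (i₀ : ℝ) + 1 := by exact_mod_cast this
    linarith
  -- the index map `j ↦ (|j| - 1)/2`
  have hidx : ∀ j ∈ J, ∃ i : ℕ, |j| = 2 * (i : ℤ) + 1 ∧ i₀ ≤ i ∧ i ≤ M := by
    intro j hj
    obtain ⟨r, hr⟩ := hodd j hj
    have h1 := hJ j hj
    have h2 := hM j hj
    refine ⟨((|j| - 1) / 2).toNat, ?_, ?_, ?_⟩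
    · rcases le_or_gt 0 j with h | h
      · rw [abs_of_nonneg h] at *; omega
      · rw [abs_of_neg h] at *; omega
    · rcases le_or_gt 0 j with h | h
      · rw [abs_of_nonneg h] at h1; rw [abs_of_nonneg h]; omega
      · rw [abs_of_neg h] at h1; rw [abs_of_neg h]; omega
    · rcases le_or_gt 0 j with h | h
      · rw [abs_of_nonneg h] at h2; rw [abs_of_nonneg h]; omega
      · rw [abs_of_neg h] at h2; rw [abs_of_neg h]; omega
  -- positive and negative parts, each injected into `Icc i₀ M`
  have hpart : ∀ (sgn : Bool), ∑ j ∈ J.filter (fun j => (0 ≤ j) = sgn), 1 / ((j : ℝ)) ^ 2 ≤ 1 / (4 * (i₀ : ℝ)) := by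
    intro sgn
    set Jp := J.filter (fun j => (0 ≤ j) = sgn) with hJp
    -- index function
    set ι : ℤ → ℕ := fun j => ((|j| - 1) / 2).toNat with hι
    have hιspec : ∀ j ∈ Jp, |j| = 2 * (ι j : ℤ) + 1 ∧ i₀ ≤ ι j ∧ ι j ≤ M := by
      intro j hj
      rw [hJp, Finset.mem_filter] at hj
      obtain ⟨i, hi, hi₀i, hiM⟩ := hidx j hj.1
      have : ι j = i := by simp only [hι, hi]; omega
      rw [this]; exact ⟨hi, hi₀i, hiM⟩
    have hinj : Set.InjOn ι (Jp : Set ℤ) := by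
      intro j hj j' hj' hjj
      have h1 := (hιspec j hj).1
      have h2 := (hιspec j' hj').1
      rw [hjj] at h1
      have habs : |j| = |j'| := by rw [h1, h2]
      rw [Finset.mem_coe, hJp, Finset.mem_filter] at hj hj'
      rcases Bool.eq_false_or_eq_true sgn with hs | hs
      · have hj0 : 0 ≤ j := by have := hj.2; rw [hs] at this; simpa using this
        have hj0' : 0 ≤ j' := by have := hj'.2; rw [hs] at this; simpa using this
        rw [abs_of_nonneg hj0, abs_of_nonneg hj0'] at habs; exact habs
      · have hj0 : j < 0 := by have := hj.2; rw [hs] at this; simpa using this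
        have hj0' : j' < 0 := by have := hj'.2; rw [hs] at this; simpa using this
        rw [abs_of_neg hj0, abs_of_neg hj0'] at habs; linarith
    have hsub : Jp.image ι ⊆ Finset.Icc i₀ M := by
      intro i hi
      rw [Finset.mem_image] at hi
      obtain ⟨j, hj, rfl⟩ := hi
      rw [Finset.mem_Icc]; exact ⟨(hιspec j hj).2.1, (hιspec j hj).2.2⟩
    have e : ∑ j ∈ Jp, 1 / ((j : ℝ)) ^ 2 = ∑ i ∈ Jp.image ι, 1 / ((2 * (i : ℝ) + 1)) ^ 2 := by
      rw [Finset.sum_image hinj]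
      refine Finset.sum_congr rfl fun j hj => ?_
      have h1 := (hιspec j hj).1
      have : (j : ℝ) ^ 2 = (2 * (ι j : ℝ) + 1) ^ 2 := by
        rw [← sq_abs, ← Int.cast_abs, h1]; push_cast; ring
      rw [this]
    rw [e]
    exact (Finset.sum_le_sum_of_subset_of_nonneg hsub fun _ _ _ => by positivity).trans (htel i₀ M hi₀1)
  have hsplit : ∑ j ∈ J, 1 / ((j : ℝ)) ^ 2 =
      ∑ j ∈ J.filter (fun j => (0 ≤ j) = true), 1 / ((j : ℝ)) ^ 2 +
        ∑ j ∈ J.filter (fun j => (0 ≤ j) = false), 1 / ((j : ℝ)) ^ 2 := by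
    rw [← Finset.sum_filter_add_sum_filter_not J (fun j => 0 ≤ j)]
    congr 1
    · refine Finset.sum_congr (Finset.filter_congr fun j _ => by simp) fun _ _ => rfl
    · refine Finset.sum_congr (Finset.filter_congr fun j _ => by simp) fun _ _ => rfl
  rw [hsplit]
  have hi₀pos : (0 : ℝ) < i₀ := by exact_mod_cast hi₀1
  calc _ ≤ 1 / (4 * (i₀ : ℝ)) + 1 / (4 * (i₀ : ℝ)) := add_le_add (hpart true) (hpart false)
    _ = 1 / (2 * (i₀ : ℝ)) := by field_simp; ring
    _ ≤ 1 / ((D : ℝ) - 1) := one_div_le_one_div_of_le (by linarith) hi₀D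

/-- **SIDEBAND ENERGY, PARITY-HALVED** (even `λ`, e.g. every fibre `λ = nγ` at even `γ`): for `D ≥ 2` and every finite
`S ⊆ {q : D ≤ |q+λ| ∧ D ≤ |q−λ|}`, `Σ_{q∈S} ‖ĝ₀(q)‖² ≤ (4/π²)·1/(D−1)` (the coefficients with `λ + q` even vanish,
`…ExactChirp.fourierCoeff_exactChirp_eq_zero_of_even`; the odd ones are summed by `sum_inv_sq_le_of_le_abs_of_odd`).
[cite: Grafakos2014, Prop. 3.1.2 (5)] -/
theorem sum_sq_norm_fourierCoeff_exactChirp_sideband_le_of_even {lam : ℤ} (hlam : Even lam) {g₀ : UnitAddCircle → ℂ}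
    (hg₀ : ∀ t : ℝ, g₀ (t : UnitAddCircle) = Complex.exp (-(2 * π * I * lam * ((tri (2 * π * t) / (2 * π) : ℝ) : ℂ))))
    (hg₀c : Continuous g₀) {D : ℕ} (hD : 2 ≤ D) (S : Finset ℤ)
    (hS : ∀ q ∈ S, (D : ℤ) ≤ |q + lam| ∧ (D : ℤ) ≤ |q - lam|) :
    ∑ q ∈ S, ‖fourierCoeff g₀ q‖ ^ 2 ≤ 4 / π ^ 2 * (1 / ((D : ℝ) - 1)) := by
  classical
  have hπ : 0 < π := Real.pi_pos
  -- only odd `q` (i.e. `λ + q` odd) contribute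
  set S₁ := S.filter (fun q : ℤ => Odd q) with hS₁
  have h1 : ∑ q ∈ S, ‖fourierCoeff g₀ q‖ ^ 2 = ∑ q ∈ S₁, ‖fourierCoeff g₀ q‖ ^ 2 := by
    rw [hS₁, Finset.sum_filter]
    refine Finset.sum_congr rfl fun q hq => ?_
    split_ifs with hodd
    · rfl
    · have h := hS q hq
      have hq1 : q ≠ -lam := by intro e; rw [e, neg_add_cancel, abs_zero] at h; have := h.1; omega
      have hq2 : q ≠ lam := by intro e; rw [e, sub_self, abs_zero] at h; have := h.2; omega
      have heven : Even (lam + q) := hlam.add (Int.not_odd_iff_even.mp hodd)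
      rw [fourierCoeff_exactChirp_eq_zero_of_even hg₀ hg₀c heven hq1 hq2]; simp
  have hterm : ∀ q ∈ S₁, ‖fourierCoeff g₀ q‖ ^ 2 ≤
      2 / π ^ 2 * (1 / (((lam + q : ℤ) : ℝ)) ^ 2 + 1 / (((lam - q : ℤ) : ℝ)) ^ 2) := by
    intro q hq
    rw [hS₁, Finset.mem_filter] at hq
    have h := hS q hq.1
    have hq1 : q ≠ -lam := by intro e; rw [e, neg_add_cancel, abs_zero] at h; have := h.1; omega
    have hq2 : q ≠ lam := by intro e; rw [e, sub_self, abs_zero] at h; have := h.2; omega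
    have hb := norm_fourierCoeff_exactChirp_le hg₀ hg₀c hq1 hq2
    have h0 : 0 ≤ ‖fourierCoeff g₀ q‖ := norm_nonneg _
    have hx : 0 < |((lam + q : ℤ) : ℝ)| := by
      rw [abs_pos]; exact_mod_cast (show lam + q ≠ 0 by omega)
    have hy : 0 < |((lam - q : ℤ) : ℝ)| := by
      rw [abs_pos]; exact_mod_cast (show lam - q ≠ 0 by omega)
    calc ‖fourierCoeff g₀ q‖ ^ 2 ≤ (1 / (π * |((lam + q : ℤ) : ℝ)|) + 1 / (π * |((lam - q : ℤ) : ℝ)|)) ^ 2 :=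
          pow_le_pow_left₀ h0 hb 2
      _ ≤ 2 * (1 / (π * |((lam + q : ℤ) : ℝ)|)) ^ 2 + 2 * (1 / (π * |((lam - q : ℤ) : ℝ)|)) ^ 2 := by
          nlinarith [sq_nonneg (1 / (π * |((lam + q : ℤ) : ℝ)|) - 1 / (π * |((lam - q : ℤ) : ℝ)|))]
      _ = 2 / π ^ 2 * (1 / (((lam + q : ℤ) : ℝ)) ^ 2 + 1 / (((lam - q : ℤ) : ℝ)) ^ 2) := by
          rw [div_pow, div_pow, mul_pow, mul_pow, sq_abs, sq_abs]
          field_simp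
  rw [h1]
  refine (Finset.sum_le_sum hterm).trans ?_
  rw [← Finset.mul_sum, Finset.sum_add_distrib]
  have hoddS₁ : ∀ q ∈ S₁, Odd q := fun q hq => by rw [hS₁, Finset.mem_filter] at hq; exact hq.2
  have hA : ∑ q ∈ S₁, 1 / (((lam + q : ℤ) : ℝ)) ^ 2 ≤ 1 / ((D : ℝ) - 1) := by
    have hinj : Set.InjOn (fun q : ℤ => lam + q) (S₁ : Set ℤ) := fun q _ q' _ h => by simpa using h
    rw [← Finset.sum_image (f := fun j : ℤ => 1 / ((j : ℝ)) ^ 2) hinj]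
    refine sum_inv_sq_le_of_le_abs_of_odd hD _ (fun j hj => ?_) (fun j hj => ?_)
    · rw [Finset.mem_image] at hj
      obtain ⟨q, hq, rfl⟩ := hj
      rw [hS₁, Finset.mem_filter] at hq
      rw [add_comm]; exact (hS q hq.1).1
    · rw [Finset.mem_image] at hj
      obtain ⟨q, hq, rfl⟩ := hj
      exact hlam.add_odd (hoddS₁ q hq)
  have hB : ∑ q ∈ S₁, 1 / (((lam - q : ℤ) : ℝ)) ^ 2 ≤ 1 / ((D : ℝ) - 1) := by
    have hinj : Set.InjOn (fun q : ℤ => lam - q) (S₁ : Set ℤ) := fun q _ q' _ h => by simpa using h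
    rw [← Finset.sum_image (f := fun j : ℤ => 1 / ((j : ℝ)) ^ 2) hinj]
    refine sum_inv_sq_le_of_le_abs_of_odd hD _ (fun j hj => ?_) (fun j hj => ?_)
    · rw [Finset.mem_image] at hj
      obtain ⟨q, hq, rfl⟩ := hj
      rw [hS₁, Finset.mem_filter] at hq
      rw [← abs_neg, neg_sub]; exact (hS q hq.1).2
    · rw [Finset.mem_image] at hj
      obtain ⟨q, hq, rfl⟩ := hj
      exact hlam.sub_odd (hoddS₁ q hq)
  have hπ2 : 0 < 2 / π ^ 2 := by positivity
  calc 2 / π ^ 2 * (∑ q ∈ S₁, 1 / (((lam + q : ℤ) : ℝ)) ^ 2 + ∑ q ∈ S₁, 1 / (((lam - q : ℤ) : ℝ)) ^ 2)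
      ≤ 2 / π ^ 2 * (1 / ((D : ℝ) - 1) + 1 / ((D : ℝ) - 1)) := mul_le_mul_of_nonneg_left (add_le_add hA hB) hπ2.le
    _ = 4 / π ^ 2 * (1 / ((D : ℝ) - 1)) := by ring

end Summit.AnomalousDissipation.AnomalousDissipation.Theorems.SawtoothPulseCascade.K1Start
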